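import Literature.Probability.LatticeModels.FermionicObservableSums
import HarnessLib

/-!
# The left bank of the medial exploration is open-connected to the arc `A`

Crux `Summit.CriticalPhenomena.CardyFormulaZ2.Theses.CardyUniqueLimit.CardyRigidity`
(stmt-CriticalPhenomena-0746), line `crossing_martingale`, stub `stub_slitCrossingData`, piece
(P-approx)(i) "event identity": conditionally on the exploration prefix, the fixed crossing event
`Q = {(u₂,u₁) ↔ (u₀,a) by an open primal path of the discrete domain}` becomes the free crossing
event of the slit domain towards `(u₀,a) ∪` LEFT BANK, because every primal vertex on the left of
the exploration is joined back to the arc `A` by the open primal edges the exploration has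
followed (Camia–Newman 2007, §4; Smirnov 2001, §2: "open edges on the left").  This file proves
that combinatorial fact for the tree's exploration (`cornerOrbit` of `MedialInterfaceProofs.lean`):

* `LeftBank.reachable_fromEdgeSet_cornerOrbit` — in any configuration `β`, the left vertex of the
  `n`-th orbit corner is joined to the left vertex of the start corner in the graph of `β`-edges
  (the left vertex either stays, across a closed edge, or moves along the open edge just
  followed);
* `LeftBank.exists_zdArcA_reachable_cornerOrbit` — for Dobrushin data and the completed
  configuration `D.bcBondConfig ω` started at a corner with vertex on `zdArcA`: the left vertex of
  every orbit corner is joined INSIDE `Ω_δ` by RAW-open edges of `ω` to some vertex of the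
  discrete arc `zdArcA` (the last contact of the bank with `A`: after it the followed edges have
  an endpoint off `A`, so they are genuinely open, non-`B` edges of `Ω_δ`).
-/

noncomputable section

open Literature.Probability.LatticeModels Literature.Probability.Percolation
open Literature.Probability.LatticeModels.DiscreteDobrushin

namespace Summit.CriticalPhenomena.CardyFormulaZ2.Cruxes.CardyRigidity.CrossingMartingale

namespace LeftBank

/-- **The left vertex moves only along `β`-edges.** For every configuration `β` and start corner
`c₀`, the left vertex `(cornerOrbit β c₀ n).1` is reachable from `c₀.1` in the graph
`fromEdgeSet β` (indeed along the followed edges `cTgt (cornerOrbit β c₀ i) ∈ β`, `i < n`).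
[cite: Smirnov2001, §2] -/
theorem reachable_fromEdgeSet_cornerOrbit (β : BondConfig (Site 2)) (c₀ : Site 2 × Fin 4) (n : ℕ) :
    (SimpleGraph.fromEdgeSet β).Reachable c₀.1 (cornerOrbit β c₀ n).1 := by
  induction n with
  | zero => exact SimpleGraph.Reachable.refl _
  | succ n ih =>
    show (SimpleGraph.fromEdgeSet β).Reachable c₀.1 (nextCorner β (cornerOrbit β c₀ n)).1
    by_cases h : cTgt (cornerOrbit β c₀ n) ∈ β
    · rw [nextCorner_of_mem h]
      refine ih.trans (SimpleGraph.Adj.reachable ?_)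
      rw [SimpleGraph.fromEdgeSet_adj]
      exact ⟨h, fun heq ↦ cornerUnit_ne_zero _ (by simpa using heq.symm)⟩
    · rw [nextCorner_of_not_mem h]
      exact ih

/-- **The left bank is raw-open-connected to the discrete arc `A` inside `Ω_δ`.**  For Dobrushin
data `D`, a configuration `ω` and a corner `c₀` with `c₀.1 ∈ D.zdArcA`, the left vertex of every
corner of the orbit of the completed configuration `D.bcBondConfig ω` is joined, in the graph of
`ω`-open edges of `Ω_δ` (`openGraph ω ⊓ discreteDomainGraph D.Ω D.δ`), to some vertex of
`D.zdArcA`.  (Induction: a followed edge whose new endpoint is off `A` is not an `A`–`A` edge, so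
its `bcBondConfig`-openness means `ω`-openness off `B`; if the new endpoint is on `A`, restart
there.) [cite: Smirnov2001, §2] [cite: CamiaNewman2007, §4] -/
theorem exists_zdArcA_reachable_cornerOrbit (D : DiscreteDobrushin) (ω : BondConfig (Site 2))
    {c₀ : Site 2 × Fin 4} (hc₀ : c₀.1 ∈ D.zdArcA) (n : ℕ) :
    ∃ w ∈ D.zdArcA, (openGraph ω ⊓ discreteDomainGraph D.Ω D.δ).Reachable w
      (cornerOrbit (D.bcBondConfig ω) c₀ n).1 := by
  induction n with
  | zero => exact ⟨c₀.1, hc₀, SimpleGraph.Reachable.refl _⟩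
  | succ n ih =>
    obtain ⟨w, hw, hr⟩ := ih
    set p := cornerOrbit (D.bcBondConfig ω) c₀ n with hp
    show ∃ w ∈ D.zdArcA, (openGraph ω ⊓ discreteDomainGraph D.Ω D.δ).Reachable w
      (nextCorner (D.bcBondConfig ω) p).1
    by_cases h : cTgt p ∈ D.bcBondConfig ω
    · rw [nextCorner_of_mem h]
      set v' := p.1 + cornerUnit (p.2 + 1) with hv'
      by_cases hv'A : v' ∈ D.zdArcA
      · exact ⟨v', hv'A, SimpleGraph.Reachable.refl _⟩
      · refine ⟨w, hw, hr.trans (SimpleGraph.Adj.reachable ?_)⟩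
        -- the followed edge `s(p.1, v')` is a raw-open edge of `Ω_δ`
        obtain ⟨he, hA | ⟨hω, -⟩⟩ := (D.mem_bcBondConfig_iff).1 h
        · exact (hv'A (hA v' (Sym2.mem_mk_right _ _))).elim
        · have hadj : (discreteDomainGraph D.Ω D.δ).Adj p.1 v' := by
            rwa [← SimpleGraph.mem_edgeSet]
          rw [SimpleGraph.inf_adj, openGraph_adj]
          exact ⟨⟨hω, hadj.ne⟩, hadj⟩
    · rw [nextCorner_of_not_mem h]
      exact ⟨w, hw, hr⟩

/-- The same for the exploration of admissible data from its start corner (`startCorner`), whose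
vertex lies on `zdArcA`. [cite: Smirnov2001, §2] -/
theorem exists_zdArcA_reachable_cornerOrbit_startCorner {D : DiscreteDobrushin}
    (hD : D.IsZdAdmissible) (ω : BondConfig (Site 2)) (n : ℕ) :
    ∃ w ∈ D.zdArcA, (openGraph ω ⊓ discreteDomainGraph D.Ω D.δ).Reachable w
      (cornerOrbit (D.bcBondConfig ω) (startCorner hD) n).1 :=
  exists_zdArcA_reachable_cornerOrbit D ω (isStartCorner_startCorner hD).mem_zdArcA n

end LeftBank

/-- **Registered form** (glue `leftBank_exists_zdArcA_reachable` of stmt-CriticalPhenomena-0746): the left vertex of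
every corner of the exploration of admissible data is joined inside `Ω_δ` by raw-open edges to the discrete arc `A`.
[cite: Smirnov2001, §2] -/
theorem leftBank_exists_zdArcA_reachable : ∀ {D : DiscreteDobrushin} (hD : D.IsZdAdmissible) (ω : BondConfig (Site 2)) (n : ℕ), ∃ w ∈ D.zdArcA, (openGraph ω ⊓ discreteDomainGraph D.Ω D.δ).Reachable w (cornerOrbit (D.bcBondConfig ω) (startCorner hD) n).1 :=
  fun hD ω n ↦ LeftBank.exists_zdArcA_reachable_cornerOrbit_startCorner hD ω n

end Summit.CriticalPhenomena.CardyFormulaZ2.Cruxes.CardyRigidity.CrossingMartingale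

end
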